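import Summits.QuantumFields.BalabanUV.Beta.GAN24.DirichletExhaustionPeriodise

/-!
# `BalabanUV.Beta.GAN24.DirichletExhaustionTails` — binder row G-an2-4 / (CONV-C), part P2, PART 13 = skeleton node S3.b: the WRAP-AROUND TAILS
# of the periodisation `Σ_{m ≠ 0} |deltaZ L k (x,α) (y + M∘m, β)|` are `≤ c166Z·K_{d+1}(κZ)·e^{κZ·|x−y|}·e^{−κZ(N−1)}` whenever all periods
# `M_i ≥ N ≥ 1` — uniformly in `k`; hence they vanish as the torus grows (unit b2b-balaban-gan24-p2, gen 1, v1)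

HONEST FRAMING (cell contract, verbatim): «discharging `BetaPertH` makes Bałaban's UV stability UNCONDITIONAL — a real constructive-QFT
result; it is NOT the continuum limit and NOT the Clay problem.»  Skeleton node S3 ((2.153) on ℤ^{d+1} by TORUS EXHAUSTION): S3.a (PART 12)
writes pv09-g6's torus matrix as `Σ'_m deltaZ(x, y + M∘m)`; THIS file bounds everything but the `m = 0` term, using only PART 8's
`k`-uniform decay `deltaZ_abs_le` and pv23's uniform lattice sums `B4Sect5Proof.latticeSum_le`.  [folklore] real analysis; nothing printed is
used; NOT `BetaPertH`, NOT continuum, NOT Clay.  «not in print; our proof attempt».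

ABSOLUTE RULE (cell, verbatim): «No internally-minted statement may enter as a cited fact. Every hypothesis is either kernel-proved in this
package or a verbatim quotation of a PUBLISHED theorem with page reference. The manuscript(s) under audit are NOT citable for their own disputed
steps — they are the thing under adjudication; programme-internal (2001/route/tribunal) claims are never citable.»

WHAT IS PROVED (0 sorry): `exists_coord_eq_dist` (the sup-distance of `ℤ^{d+1}` is attained at a coordinate), `dist_translate_ge` (for `m ≠ 0`,
`M_i ≥ N ≥ 1`: `dist x (y + M∘m) ≥ (N − 1) + dist m 0 − dist x y`), `summable_expDist`/`tsum_expDist_le` (Σ_m e^{−a·dist m 0} ≤ K_{d+1}(a)),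
`deltaZ_translate_abs_le` (termwise), **`deltaZ_tail_tsum_le`** (the tail bound), **`deltaPol_sub_deltaZ_abs_le`** (with PART 12:
`|deltaPol M (L^k) p q − deltaZ L k p q| ≤ tailConst·e^{κZ·dist}·e^{−κZ(N−1)}`).  NOT summit progress.
-/

namespace Summit.QuantumFields.BalabanUV.Beta.GAN24.DirichletExhaustionTails

open Finset Real
open Literature.MathematicalPhysics.QuantumFieldTheory.Balaban1983to89
open B4Sect5Proof (latticeConst latticeConst_nonneg latticeSum_le)
open B4TorusKernel.MultiPeriod (translate translate_apply translate_injective)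
open B6Lemma24Torus (pbox)
open B6Cov2156Torus (deltaPol)
open B4Sect5Exhaustion (K)
open Summit.QuantumFields.BalabanUV.Beta.GAN24.DirichletExhaustionDeltaZ (deltaZ c166Z kappaZ kappaZ_pos deltaZ_abs_le)
open Summit.QuantumFields.BalabanUV.Beta.GAN24.DirichletExhaustionPeriodise (deltaPol_eq_tsum_deltaZ one_le_M)

noncomputable section

variable {d : ℕ}

/-! ## §1 Sup-distance bookkeeping on `ℤ^{d+1}` -/

/-- The sup-distance to `0` is attained at some coordinate: `∃ i, dist m 0 = |m i|`. -/
theorem exists_coord_eq_dist (m : Fin (d + 1) → ℤ) : ∃ i : Fin (d + 1), dist m 0 = |((m i : ℤ) : ℝ)| := by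
  obtain ⟨i, _, hi⟩ := Finset.exists_mem_eq_sup (Finset.univ : Finset (Fin (d + 1))) Finset.univ_nonempty
    (fun b => nndist (m b) ((0 : Fin (d + 1) → ℤ) b))
  refine ⟨i, ?_⟩
  rw [dist_pi_def, hi, coe_nndist, Pi.zero_apply, Int.dist_eq, Int.cast_zero, sub_zero]

/-- Each coordinate difference is bounded by the sup-distance. -/
theorem abs_sub_le_dist (x z : Fin (d + 1) → ℤ) (i : Fin (d + 1)) : |((x i : ℤ) : ℝ) - (z i : ℝ)| ≤ dist x z := by
  rw [← Int.dist_eq]; exact dist_le_pi_dist x z i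

/-- **Translates are far**: for `m ≠ 0` and periods `M_i ≥ N ≥ 1`, `dist x (y + M∘m) ≥ (N − 1) + dist m 0 − dist x y`. -/
theorem dist_translate_ge {M : Fin (d + 1) → ℕ} {N : ℕ} (hN : 1 ≤ N) (hMN : ∀ i, N ≤ M i) (x y : Fin (d + 1) → ℤ)
    {m : Fin (d + 1) → ℤ} (hm : m ≠ 0) : ((N : ℝ) - 1) + dist m 0 - dist x y ≤ dist x (translate M y m) := by
  obtain ⟨i, hi⟩ := exists_coord_eq_dist m
  have hm1 : (1 : ℝ) ≤ dist m 0 := by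
    have h0 : 0 < dist m 0 := dist_pos.mpr hm
    rw [dist_pi_def] at h0 ⊢
    obtain ⟨j, _, hj⟩ := Finset.exists_mem_eq_sup (Finset.univ : Finset (Fin (d + 1))) Finset.univ_nonempty
      (fun b => nndist (m b) ((0 : Fin (d + 1) → ℤ) b))
    rw [hj] at h0 ⊢
    rw [coe_nndist, Pi.zero_apply, Int.dist_eq, Int.cast_zero, sub_zero] at h0 ⊢
    have : m j ≠ 0 := by
      intro h; rw [h] at h0; simp at h0
    have : (1 : ℤ) ≤ |m j| := Int.one_le_abs this
    exact_mod_cast this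
  have hmi : |((m i : ℤ) : ℝ)| = dist m 0 := hi.symm
  have h1 := abs_sub_le_dist x (translate M y m) i
  have h2 := abs_sub_le_dist x y i
  rw [translate_apply] at h1
  push_cast at h1
  have hMi : (N : ℝ) ≤ (M i : ℝ) := by exact_mod_cast hMN i
  have hN1 : (1 : ℝ) ≤ N := by exact_mod_cast hN
  -- |x_i - y_i - M_i m_i| ≥ M_i |m_i| - |x_i - y_i|
  have h3 : (M i : ℝ) * |((m i : ℤ) : ℝ)| - |((x i : ℤ) : ℝ) - (y i : ℝ)| ≤ |((x i : ℤ) : ℝ) - ((y i : ℝ) + (M i : ℝ) * (m i : ℝ))| := by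
    have e : ((x i : ℤ) : ℝ) - ((y i : ℝ) + (M i : ℝ) * (m i : ℝ)) = (((x i : ℤ) : ℝ) - (y i : ℝ)) - (M i : ℝ) * (m i : ℝ) := by ring
    rw [e]
    have := abs_sub_abs_le_abs_sub ((M i : ℝ) * (m i : ℝ)) (((x i : ℤ) : ℝ) - (y i : ℝ))
    rw [abs_sub_comm ((M i : ℝ) * (m i : ℝ))] at this
    rw [abs_mul, Nat.abs_cast] at this
    linarith
  -- M_i |m_i| ≥ N |m_i| ≥ (N-1) + |m_i|
  have h4 : ((N : ℝ) - 1) + |((m i : ℤ) : ℝ)| ≤ (M i : ℝ) * |((m i : ℤ) : ℝ)| := by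
    rw [hmi]; nlinarith
  linarith

/-! ## §2 Uniform exponential lattice sums on `ℤ^{d+1}` -/

/-- `m ↦ e^{−a·dist m 0}` is summable on `ℤ^{d+1}` with sum `≤ K_{d+1}(a)` (pv23's `latticeSum_le` on every finite set). -/
theorem summable_expDist {a : ℝ} (ha : 0 < a) :
    Summable (fun m : Fin (d + 1) → ℤ => Real.exp (-(a * dist (0 : Fin (d + 1) → ℤ) m))) ∧
    ∑' m : Fin (d + 1) → ℤ, Real.exp (-(a * dist (0 : Fin (d + 1) → ℤ) m)) ≤ latticeConst (d + 1) a := by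
  have hb : ∀ S : Finset (Fin (d + 1) → ℤ), ∑ m ∈ S, Real.exp (-(a * dist (0 : Fin (d + 1) → ℤ) m)) ≤ latticeConst (d + 1) a :=
    fun S => latticeSum_le (d + 1) ha S 0
  have hs := summable_of_sum_le (fun m => (Real.exp_pos _).le) hb
  exact ⟨hs, hs.tsum_le_of_sum_le hb⟩

/-! ## §3 The tail bound -/

/-- The tail constant `c166Z·K_{d+1}(κZ)`. -/
def tailConst (d : ℕ) : ℝ := c166Z d * latticeConst (d + 1) (kappaZ d)

/-- Termwise: for `m ≠ 0` and `M_i ≥ N ≥ 1`,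
`|deltaZ L k (x,α) (y + M∘m, β)| ≤ c166Z·e^{κZ·dist x y}·e^{−κZ(N−1)}·e^{−κZ·dist 0 m}`. -/
theorem deltaZ_translate_abs_le (L : ℕ) [NeZero L] (k : ℕ) {M : Fin (d + 1) → ℕ} {N : ℕ} (hN : 1 ≤ N) (hMN : ∀ i, N ≤ M i)
    (x y : Fin (d + 1) → ℤ) (α β : Fin (d + 1)) {m : Fin (d + 1) → ℤ} (hm : m ≠ 0) :
    |deltaZ L k (x, α) (translate M y m, β)| ≤
      c166Z d * Real.exp (kappaZ d * dist x y) * Real.exp (-(kappaZ d * ((N : ℝ) - 1))) *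
        Real.exp (-(kappaZ d * dist (0 : Fin (d + 1) → ℤ) m)) := by
  have hκ := kappaZ_pos d
  refine (deltaZ_abs_le L k (x, α) (translate M y m, β)).trans ?_
  have hd := dist_translate_ge hN hMN x y hm
  rw [dist_comm m 0] at hd
  rw [mul_assoc, mul_assoc, ← Real.exp_add, ← Real.exp_add]
  refine mul_le_mul_of_nonneg_left (Real.exp_le_exp.mpr ?_) ?_
  · nlinarith
  · unfold c166Z; have := B5Symbol166Strip.MG_pos (d + 1); positivity

/-- **THE WRAP-AROUND TAIL BOUND (S3.b)**: for periods `M_i ≥ N ≥ 1`, uniformly in `k`,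
`Σ'_m [m ≠ 0]·|deltaZ L k (x,α) (y + M∘m, β)| ≤ tailConst(d)·e^{κZ·dist x y}·e^{−κZ(N−1)}` (and the family is summable). -/
theorem deltaZ_tail_tsum_le (L : ℕ) [NeZero L] (k : ℕ) {M : Fin (d + 1) → ℕ} {N : ℕ} (hN : 1 ≤ N) (hMN : ∀ i, N ≤ M i)
    (x y : Fin (d + 1) → ℤ) (α β : Fin (d + 1)) :
    Summable (fun m : Fin (d + 1) → ℤ => if m = 0 then (0 : ℝ) else |deltaZ L k (x, α) (translate M y m, β)|) ∧
    ∑' m : Fin (d + 1) → ℤ, (if m = 0 then (0 : ℝ) else |deltaZ L k (x, α) (translate M y m, β)|) ≤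
      tailConst d * Real.exp (kappaZ d * dist x y) * Real.exp (-(kappaZ d * ((N : ℝ) - 1))) := by
  have hκ := kappaZ_pos d
  obtain ⟨hs, hle⟩ := summable_expDist (d := d) hκ
  set W := c166Z d * Real.exp (kappaZ d * dist x y) * Real.exp (-(kappaZ d * ((N : ℝ) - 1))) with hW
  have hW0 : 0 ≤ W := by rw [hW]; unfold c166Z; have := B5Symbol166Strip.MG_pos (d + 1); positivity
  have hterm : ∀ m : Fin (d + 1) → ℤ, (if m = 0 then (0 : ℝ) else |deltaZ L k (x, α) (translate M y m, β)|) ≤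
      W * Real.exp (-(kappaZ d * dist (0 : Fin (d + 1) → ℤ) m)) := by
    intro m
    split_ifs with h
    · positivity
    · exact deltaZ_translate_abs_le L k hN hMN x y α β h
  have hnn : ∀ m : Fin (d + 1) → ℤ, 0 ≤ (if m = 0 then (0 : ℝ) else |deltaZ L k (x, α) (translate M y m, β)|) := by
    intro m; split_ifs <;> positivity
  have hsum : Summable fun m : Fin (d + 1) → ℤ => (if m = 0 then (0 : ℝ) else |deltaZ L k (x, α) (translate M y m, β)|) :=
    (hs.mul_left W).of_nonneg_of_le hnn hterm
  refine ⟨hsum, ?_⟩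
  calc ∑' m : Fin (d + 1) → ℤ, (if m = 0 then (0 : ℝ) else |deltaZ L k (x, α) (translate M y m, β)|)
      ≤ ∑' m : Fin (d + 1) → ℤ, W * Real.exp (-(kappaZ d * dist (0 : Fin (d + 1) → ℤ) m)) :=
        hsum.tsum_le_tsum hterm (hs.mul_left W)
    _ = W * ∑' m : Fin (d + 1) → ℤ, Real.exp (-(kappaZ d * dist (0 : Fin (d + 1) → ℤ) m)) := tsum_mul_left
    _ ≤ W * latticeConst (d + 1) (kappaZ d) := mul_le_mul_of_nonneg_left hle hW0
    _ = tailConst d * Real.exp (kappaZ d * dist x y) * Real.exp (-(kappaZ d * ((N : ℝ) - 1))) := by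
        rw [hW]; unfold tailConst; ring

/-! ## §4 Torus versus lattice, entrywise (with PART 12) -/

/-- **`|deltaPol M (L^k) p q − deltaZ L k p q| ≤ tailConst·e^{κZ·dist}·e^{−κZ(N−1)}`** for all bonds of the torus box, whenever all periods
`M_i ≥ N ≥ 1`: the torus matrix entry differs from the infinite-lattice entry by the wrap-around tail only (PART 12 `deltaPol_eq_tsum_deltaZ`). -/
theorem deltaPol_sub_deltaZ_abs_le (L : ℕ) [NeZero L] (k : ℕ) (M : Fin (d + 1) → ℕ) [∀ μ, NeZero (M μ)] {N : ℕ} (hN : 1 ≤ N)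
    (hMN : ∀ i, N ≤ M i) (p q : B4.Idx (pbox M) (d + 1)) :
    |deltaPol M (L ^ k) p q - deltaZ L k ((p.1 : Fin (d + 1) → ℤ), p.2) ((q.1 : Fin (d + 1) → ℤ), q.2)| ≤
      tailConst d * Real.exp (kappaZ d * dist (p.1 : Fin (d + 1) → ℤ) (q.1 : Fin (d + 1) → ℤ)) *
        Real.exp (-(kappaZ d * ((N : ℝ) - 1))) := by
  set x : Fin (d + 1) → ℤ := (p.1 : Fin (d + 1) → ℤ)
  set y : Fin (d + 1) → ℤ := (q.1 : Fin (d + 1) → ℤ)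
  obtain ⟨hs, hle⟩ := deltaZ_tail_tsum_le L k hN hMN x y p.2 q.2
  -- the full periodised family is summable: tail + the single `m = 0` term
  set f : (Fin (d + 1) → ℤ) → ℝ := fun m => deltaZ L k (x, p.2) (translate M y m, q.2) with hf
  have hf0 : f 0 = deltaZ L k (x, p.2) (y, q.2) := by
    simp only [hf]
    congr 2
    funext i; simp
  have hsplit : ∀ m, f m = (if m = 0 then f 0 else 0) + (if m = 0 then 0 else f m) := by
    intro m; split_ifs with h <;> simp [h]
  have htail_s : Summable fun m : Fin (d + 1) → ℤ => if m = 0 then (0 : ℝ) else f m := by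
    refine hs.of_norm_bounded fun m => ?_
    simp only [hf]
    split_ifs <;> simp
  have hsingle_s : Summable fun m : Fin (d + 1) → ℤ => if m = 0 then f 0 else (0 : ℝ) :=
    summable_of_ne_finset_zero (s := {0}) (fun m hm => by rw [Finset.mem_singleton] at hm; rw [if_neg hm])
  have hfs : Summable f := by
    have := hsingle_s.add htail_s
    exact this.congr fun m => (hsplit m).symm
  rw [deltaPol_eq_tsum_deltaZ M L k p q]
  change |∑' m, f m - deltaZ L k (x, p.2) (y, q.2)| ≤ _
  have hdecomp : ∑' m, f m = f 0 + ∑' m, (if m = 0 then (0 : ℝ) else f m) := by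
    rw [show (∑' m, f m) = ∑' m, ((if m = 0 then f 0 else 0) + (if m = 0 then 0 else f m)) from tsum_congr hsplit,
      hsingle_s.tsum_add htail_s, tsum_ite_eq]
  rw [hdecomp, hf0, add_sub_cancel_left]
  have heq : (fun m : Fin (d + 1) → ℤ => |if m = 0 then (0 : ℝ) else f m|) =
      fun m => if m = 0 then (0 : ℝ) else |deltaZ L k (x, p.2) (translate M y m, q.2)| := by
    funext m; split_ifs <;> simp [hf]
  have hnorm_s : Summable fun m : Fin (d + 1) → ℤ => ‖if m = 0 then (0 : ℝ) else f m‖ := by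
    simp only [Real.norm_eq_abs]; rw [heq]; exact hs
  have h1 : |∑' m, (if m = 0 then (0 : ℝ) else f m)| ≤ ∑' m, |if m = 0 then (0 : ℝ) else f m| := by
    have := norm_tsum_le_tsum_norm hnorm_s
    simpa only [Real.norm_eq_abs] using this
  refine h1.trans ?_
  rw [heq]
  exact hle

end

end Summit.QuantumFields.BalabanUV.Beta.GAN24.DirichletExhaustionTails
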